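import Summits.AtomisticToContinuum.FouriersLaw.Theorems.ParityLiouvilleSeedLiouvilleForHeatHarmonicGaussIBP
import Summits.AtomisticToContinuum.FouriersLaw.Theorems.BondHeatUncertaintyExtensiveSnapshotIrreversibilityEnergyWindowSkeletonLaw

/-!
# Crux `ExtensiveSnapshotIrreversibility` (stmt-AtomisticToContinuum-9121): skeleton Gaussian
integration by parts

Cell decomp-a2c, lens «grading / quantitative ladder», generation 78, part S, file 2 of 4 (critic
row 1077 (d)).  GENERIC: imports file 1 `…EnergyWindowSkeletonLaw` and the tree Theorems file
`ParityLiouvilleSeedLiouvilleForHeatHarmonicGaussIBP` (its Stein identity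
`gaussian_integral_byParts` on product Gaussians is CITED, not restated), hence only tree files
below it; everything here is PROVED.

§1 (I-s4) GAUSSIAN INTEGRATION BY PARTS ON SKELETON SPACE.  For the product Gaussian
`N(0,v)^{⊗ι}` on `ι → ℝ` (`piGaussian_ibp` = the cited tree identity at constant variance) and,
transported along `sumPiEquivProdPi`, on `PairSkeleton m = (Fin 2^m → ℝ)²` with the tree's
coordinates `coordX`, `basisX` (`LangevinChainKernelDensity`):
`∫ x_j F dskelGauss = 2^{-m} ∫ ∂_j F dskelGauss` (`skelGauss_ibp`) and its DIVERGENCE FORM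
`∫ G · (Σ_j x_j u_j − 2^{-m} Σ_j ∂_j u_j) = 2^{-m} ∫ Σ_j (∂_j G) u_j` (`skelGauss_ibp_div`) — the
bracket is literally part R's `skelSkorokhod m u` (file 3 restates it so) — for differentiable
`G`, `u_j` under the four integrability hypotheses `G u_j, x_j G u_j, (∂_j G) u_j, G ∂_j u_j ∈ L¹`
(INTEGRABILITY, not growth classes: the skeleton integrands of part T grow like `e^{C‖x‖}` and
their integrability is the content of the leaf (SWM) of part R).
§2 THE SAME UNDER THE TWO-BATH WIENER MEASURE (disintegration of file 1 §1 + §1 here at almost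
every remainder): `E[G(Ξ,R) · (Σ_j Ξ_j u_j(Ξ,R) − 2^{-m} Σ_j ∂_j u_j(Ξ,R))]
= 2^{-m} E[Σ_j ∂_j G(Ξ,R) u_j(Ξ,R)]` (`wienerPair_skeleton_ibp_div`), the form consumed by part T
(with `G = g ∘ E^{s}_{m,z,R}` and `u` the arrival / departure field of part R, whose
integrability is the content of the leaf (SWM)).
No new leaves; no new instance / notation / option.
References: D. Nualart, The Malliavin Calculus and Related Topics (2006), Lemma 1.1.1 and
Prop. 1.3.1 (finite-dimensional Gaussian integration by parts; the divergence as the adjoint of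
the gradient); C. Stein, Proc. Sixth Berkeley Symp. Math. Statist. Probab. 2 (1972) 583–602
(Stein's identity). [folklore]
-/

noncomputable section

namespace Summit.AtomisticToContinuum.FouriersLaw.Theorems.ExtensiveSnapshotIrreversibility.EnergyWindow

open MeasureTheory ProbabilityTheory Filter Topology Set
open scoped ENNReal NNReal
open Literature.Probability.Process Literature.MathematicalPhysics.KineticTheory.HeatConduction
open Literature.Probability.Process.KolmogorovChentsov (dyad)

/-! ## 1. (I-s4) Gaussian integration by parts on skeleton space -/

section PiIBP

variable {v : ℝ≥0}

/-- **Gaussian integration by parts for the product Gaussian `N(0,v)^{⊗ι}`**, any finite index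
type: `∫ x_j G dγ = v ∫ ∂_j G dγ` for differentiable `G` with `G`, `x_j G`, `∂_j G` integrable.
This IS the tree's Stein identity `ParityLiouvilleSeed.HarmonicWitness.gaussian_integral_byParts`
(general variances `vᵢ`, derivative family `HasFDerivAt H (H' z) z`) at constant variance with
`H' = fderiv ℝ G` — CITED, not re-proved. [cite: Nualart2006, Lemma 1.1.1] -/
theorem piGaussian_ibp {ι : Type} [Fintype ι] [DecidableEq ι] (hv : v ≠ 0) (j : ι)
    {G : (ι → ℝ) → ℝ} (hG : Differentiable ℝ G)
    (hGi : Integrable G (Measure.pi fun _ : ι => gaussianReal 0 v))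
    (hxGi : Integrable (fun x => x j * G x) (Measure.pi fun _ : ι => gaussianReal 0 v))
    (hG'i : Integrable (fun x => fderiv ℝ G x (Pi.single j 1))
      (Measure.pi fun _ : ι => gaussianReal 0 v)) :
    ∫ x, x j * G x ∂(Measure.pi fun _ : ι => gaussianReal 0 v) =
      v * ∫ x, fderiv ℝ G x (Pi.single j 1) ∂(Measure.pi fun _ : ι => gaussianReal 0 v) :=
  (ParityLiouvilleSeed.HarmonicWitness.gaussian_integral_byParts (fun _ : ι => v) (fun _ => hv)
    (fun z => (hG z).hasFDerivAt) j hGi hG'i hxGi).symm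

end PiIBP

section SkelIBP

variable (m : ℕ)

/-- The coordinate identification `(Fin 2^m ⊕ Fin 2^m → ℝ) ≃ PairSkeleton m` (Mathlib's
`sumPiEquivProdPi`) as a continuous linear equivalence. [folklore] -/
def skelCoordEquiv : (Fin (2 ^ m) ⊕ Fin (2 ^ m) → ℝ) ≃L[ℝ] PairSkeleton m :=
  ContinuousLinearEquiv.sumPiEquivProdPi ℝ (Fin (2 ^ m)) (Fin (2 ^ m)) (fun _ => ℝ)

/-- The coordinate identification, evaluated. [folklore] -/
theorem skelCoordEquiv_apply (f : Fin (2 ^ m) ⊕ Fin (2 ^ m) → ℝ) :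
    skelCoordEquiv m f = (fun i => f (Sum.inl i), fun i => f (Sum.inr i)) := rfl

/-- The coordinate identification inverts the tree's `coordX`. [folklore] -/
@[simp] theorem coordX_skelCoordEquiv (f : Fin (2 ^ m) ⊕ Fin (2 ^ m) → ℝ) :
    coordX m (skelCoordEquiv m f) = f := by
  funext j
  cases j <;> rfl

/-- The coordinate identification maps the coordinate vectors to the tree's `basisX`.
[folklore] -/
theorem skelCoordEquiv_single (j : Fin (2 ^ m) ⊕ Fin (2 ^ m)) :
    skelCoordEquiv m (Pi.single j 1) = basisX m j := by
  rw [skelCoordEquiv_apply]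
  cases j with
  | inl k =>
    refine Prod.ext (funext fun i => ?_) (funext fun i => ?_) <;>
      simp [basisX, Pi.single_apply]
  | inr k =>
    refine Prod.ext (funext fun i => ?_) (funext fun i => ?_) <;>
      simp [basisX, Pi.single_apply]

/-- The skeleton Gaussian is the image of `N(0, 2^{-m})^{⊗(Fin 2^m ⊕ Fin 2^m)}` under the
coordinate identification (Mathlib `measurePreserving_sumPiEquivProdPi`). [folklore] -/
theorem measurePreserving_skelCoordEquiv :
    MeasurePreserving (MeasurableEquiv.sumPiEquivProdPi fun _ : Fin (2 ^ m) ⊕ Fin (2 ^ m) => ℝ)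
      (Measure.pi fun _ : Fin (2 ^ m) ⊕ Fin (2 ^ m) => gaussianReal 0 (skelVar m)) (skelGauss m) :=
  measurePreserving_sumPiEquivProdPi fun _ : Fin (2 ^ m) ⊕ Fin (2 ^ m) => gaussianReal 0 (skelVar m)

/-- Each skeleton coordinate is measurable. [folklore] -/
theorem measurable_coordX (j : Fin (2 ^ m) ⊕ Fin (2 ^ m)) :
    Measurable fun x : PairSkeleton m => coordX m x j := by
  cases j with
  | inl k => exact (measurable_pi_apply k).comp measurable_fst
  | inr k => exact (measurable_pi_apply k).comp measurable_snd

/-- **(I-s4) Gaussian integration by parts on skeleton space**: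
`∫ x_j F d skelGauss = 2^{-m} ∫ ∂_j F d skelGauss` for differentiable `F : PairSkeleton m → ℝ`
with `F`, `x_j F`, `∂_j F` integrable (`x_j = coordX m x j`, `∂_j = fderiv · (basisX m j)`).
[cite: Nualart2006, Lemma 1.1.1] -/
theorem skelGauss_ibp (j : Fin (2 ^ m) ⊕ Fin (2 ^ m)) {F : PairSkeleton m → ℝ}
    (hF : Differentiable ℝ F) (hFi : Integrable F (skelGauss m))
    (hxFi : Integrable (fun x => coordX m x j * F x) (skelGauss m))
    (hF'i : Integrable (fun x => fderiv ℝ F x (basisX m j)) (skelGauss m)) :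
    ∫ x, coordX m x j * F x ∂(skelGauss m) =
      ((2 : ℝ) ^ m)⁻¹ * ∫ x, fderiv ℝ F x (basisX m j) ∂(skelGauss m) := by
  set Ψ := MeasurableEquiv.sumPiEquivProdPi fun _ : Fin (2 ^ m) ⊕ Fin (2 ^ m) => ℝ with hΨ
  have hmp := measurePreserving_skelCoordEquiv m
  have hint : ∀ f : PairSkeleton m → ℝ, ∫ x, f x ∂(skelGauss m) =
      ∫ g, f (skelCoordEquiv m g)
        ∂(Measure.pi fun _ : Fin (2 ^ m) ⊕ Fin (2 ^ m) => gaussianReal 0 (skelVar m)) :=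
    fun f => (hmp.integral_comp Ψ.measurableEmbedding f).symm
  have hintg : ∀ {f : PairSkeleton m → ℝ}, Integrable f (skelGauss m) →
      Integrable (fun g => f (skelCoordEquiv m g))
        (Measure.pi fun _ : Fin (2 ^ m) ⊕ Fin (2 ^ m) => gaussianReal 0 (skelVar m)) :=
    fun hf => (hmp.integrable_comp_emb Ψ.measurableEmbedding).2 hf
  have hFE : Differentiable ℝ (fun g => F (skelCoordEquiv m g)) :=
    hF.comp (skelCoordEquiv m).differentiable
  have hfd : ∀ g, fderiv ℝ (fun g => F (skelCoordEquiv m g)) g (Pi.single j 1) =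
      fderiv ℝ F (skelCoordEquiv m g) (basisX m j) := by
    intro g
    rw [show (fun g => F (skelCoordEquiv m g)) = F ∘ (skelCoordEquiv m) from rfl,
      fderiv_comp g (hF _) (skelCoordEquiv m).differentiableAt, (skelCoordEquiv m).fderiv,
      ContinuousLinearMap.comp_apply, ContinuousLinearEquiv.coe_coe, skelCoordEquiv_single]
  have hcoord : ∀ g, coordX m (skelCoordEquiv m g) j = g j :=
    fun g => congrFun (coordX_skelCoordEquiv m g) j
  rw [hint (fun x => coordX m x j * F x), hint (fun x => fderiv ℝ F x (basisX m j))]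
  simp only [hcoord, ← hfd]
  rw [← coe_skelVar]
  refine piGaussian_ibp (skelVar_ne_zero m) j hFE (hintg hFi) ?_ ?_
  · simpa only [hcoord] using hintg hxFi
  · simpa only [← hfd] using hintg hF'i

/-- The derivative of a product along a coordinate vector. [folklore] -/
theorem fderiv_mul_apply_basisX {G w : PairSkeleton m → ℝ} {x : PairSkeleton m}
    (hG : DifferentiableAt ℝ G x) (hw : DifferentiableAt ℝ w x) (j : Fin (2 ^ m) ⊕ Fin (2 ^ m)) :
    fderiv ℝ (fun y => G y * w y) x (basisX m j) =
      fderiv ℝ G x (basisX m j) * w x + G x * fderiv ℝ w x (basisX m j) := by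
  rw [fderiv_fun_mul hG hw]
  simp [smul_eq_mul]
  ring

/-- **(I-s4) Divergence form of the skeleton integration by parts** (the level-`m` Gaussian
divergence is the adjoint of `2^{-m}⟨∇·, u⟩`):
`∫ G · (Σ_j x_j u_j − 2^{-m} Σ_j ∂_j u_j) d skelGauss = 2^{-m} ∫ Σ_j (∂_j G) u_j d skelGauss`
for differentiable `G`, `u_j` with `G u_j`, `x_j G u_j`, `(∂_j G) u_j`, `G ∂_j u_j` integrable; the
bracket is part R's `skelSkorokhod m u x`. [cite: Nualart2006, Prop 1.3.1] -/
theorem skelGauss_ibp_div {G : PairSkeleton m → ℝ}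
    {u : PairSkeleton m → Fin (2 ^ m) ⊕ Fin (2 ^ m) → ℝ}
    (hG : Differentiable ℝ G) (hu : ∀ j, Differentiable ℝ fun y => u y j)
    (hGu : ∀ j, Integrable (fun x => G x * u x j) (skelGauss m))
    (hxGu : ∀ j, Integrable (fun x => coordX m x j * (G x * u x j)) (skelGauss m))
    (hdGu : ∀ j, Integrable (fun x => fderiv ℝ G x (basisX m j) * u x j) (skelGauss m))
    (hGdu : ∀ j, Integrable (fun x => G x * fderiv ℝ (fun y => u y j) x (basisX m j))
      (skelGauss m)) :
    ∫ x, G x * ((∑ j, coordX m x j * u x j) -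
        ((2 : ℝ) ^ m)⁻¹ * ∑ j, fderiv ℝ (fun y => u y j) x (basisX m j)) ∂(skelGauss m) =
      ((2 : ℝ) ^ m)⁻¹ * ∫ x, ∑ j, fderiv ℝ G x (basisX m j) * u x j ∂(skelGauss m) := by
  set c : ℝ := ((2 : ℝ) ^ m)⁻¹ with hc
  have hprod : ∀ j x, fderiv ℝ (fun y => G y * u y j) x (basisX m j) =
      fderiv ℝ G x (basisX m j) * u x j + G x * fderiv ℝ (fun y => u y j) x (basisX m j) :=
    fun j x => fderiv_mul_apply_basisX m (hG x) (hu j x) j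
  -- coordinate-wise identity
  have hj : ∀ j, ∫ x, coordX m x j * (G x * u x j) ∂(skelGauss m) =
      c * (∫ x, fderiv ℝ G x (basisX m j) * u x j ∂(skelGauss m) +
        ∫ x, G x * fderiv ℝ (fun y => u y j) x (basisX m j) ∂(skelGauss m)) := by
    intro j
    have hsum : Integrable (fun x => fderiv ℝ (fun y => G y * u y j) x (basisX m j))
        (skelGauss m) :=
      ((hdGu j).add (hGdu j)).congr (ae_of_all _ fun x => (hprod j x).symm)
    rw [skelGauss_ibp m j (hG.fun_mul (hu j)) (hGu j) (hxGu j) hsum,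
      ← integral_add (hdGu j) (hGdu j)]
    exact congrArg (c * ·) (integral_congr_ae (ae_of_all _ fun x => hprod j x))
  -- expand the left-hand side
  have hlhs : (fun x => G x * ((∑ j, coordX m x j * u x j) -
      c * ∑ j, fderiv ℝ (fun y => u y j) x (basisX m j))) = fun x =>
      (∑ j, coordX m x j * (G x * u x j)) -
        c * ∑ j, G x * fderiv ℝ (fun y => u y j) x (basisX m j) := by
    funext x
    simp only [mul_sub, Finset.mul_sum]
    congr 1
    · exact Finset.sum_congr rfl fun j _ => by ring
    · exact Finset.sum_congr rfl fun j _ => by ring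
  rw [hlhs, integral_sub (integrable_finsetSum _ fun j _ => hxGu j)
    ((integrable_finsetSum _ fun j _ => hGdu j).const_mul c),
    integral_finsetSum _ fun j _ => hxGu j, integral_const_mul,
    integral_finsetSum _ fun j _ => hGdu j,
    integral_finsetSum _ fun j _ => hdGu j, Finset.mul_sum, Finset.mul_sum]
  simp only [hj]
  rw [← Finset.sum_sub_distrib]
  exact Finset.sum_congr rfl fun j _ => by ring

end SkelIBP

/-! ## 2. The skeleton integration by parts under the two-bath Wiener measure -/

section Wiener

variable (m : ℕ)

/-- **(I-s4) under `E`: the skeleton integration by parts along the driving path.**  For a jointly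
measurable functional `G` and coordinate field `u` of (skeleton, remainder), differentiable in the
skeleton at every remainder, with `G u_j`, `x_j G u_j`, `(∂_j G) u_j`, `G ∂_j u_j` integrable along
the driving path (`x = Ξ_m wp`, `r = R_m wp`):
`E[G(Ξ,R) · (Σ_j Ξ_j u_j(Ξ,R) − 2^{-m} Σ_j ∂_j u_j(Ξ,R))] = 2^{-m} E[Σ_j ∂_j G(Ξ,R) u_j(Ξ,R)]` —
disintegration over the skeleton (file 1 §1) and the divergence form (§1) at almost every
remainder.
[cite: Nualart2006, Prop 1.3.1] -/
theorem wienerPair_skeleton_ibp_div {G : PairSkeleton m × WienerPair → ℝ}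
    {u : PairSkeleton m × WienerPair → Fin (2 ^ m) ⊕ Fin (2 ^ m) → ℝ}
    (hGm : Measurable G) (hum : ∀ j, Measurable fun p => u p j)
    (hdGm : ∀ j, Measurable fun p : PairSkeleton m × WienerPair =>
      fderiv ℝ (fun y => G (y, p.2)) p.1 (basisX m j))
    (hdum : ∀ j, Measurable fun p : PairSkeleton m × WienerPair =>
      fderiv ℝ (fun y => u (y, p.2) j) p.1 (basisX m j))
    (hGd : ∀ r, Differentiable ℝ fun y => G (y, r))
    (hud : ∀ r j, Differentiable ℝ fun y => u (y, r) j)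
    (hGu : ∀ j, Integrable (fun wp => G (pairSkel m wp, pairRem m wp) *
      u (pairSkel m wp, pairRem m wp) j) wienerPair)
    (hxGu : ∀ j, Integrable (fun wp => coordX m (pairSkel m wp) j *
      (G (pairSkel m wp, pairRem m wp) * u (pairSkel m wp, pairRem m wp) j)) wienerPair)
    (hdGu : ∀ j, Integrable (fun wp =>
      fderiv ℝ (fun y => G (y, pairRem m wp)) (pairSkel m wp) (basisX m j) *
        u (pairSkel m wp, pairRem m wp) j) wienerPair)
    (hGdu : ∀ j, Integrable (fun wp => G (pairSkel m wp, pairRem m wp) *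
      fderiv ℝ (fun y => u (y, pairRem m wp) j) (pairSkel m wp) (basisX m j)) wienerPair) :
    ∫ wp, G (pairSkel m wp, pairRem m wp) *
        ((∑ j, coordX m (pairSkel m wp) j * u (pairSkel m wp, pairRem m wp) j) -
          ((2 : ℝ) ^ m)⁻¹ * ∑ j, fderiv ℝ (fun y => u (y, pairRem m wp) j) (pairSkel m wp)
            (basisX m j)) ∂wienerPair =
      ((2 : ℝ) ^ m)⁻¹ * ∫ wp, ∑ j,
        fderiv ℝ (fun y => G (y, pairRem m wp)) (pairSkel m wp) (basisX m j) *
          u (pairSkel m wp, pairRem m wp) j ∂wienerPair := by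
  -- the two integrands as functionals of (skeleton, remainder)
  set ΦL : PairSkeleton m × WienerPair → ℝ := fun p => G p *
    ((∑ j, coordX m p.1 j * u p j) -
      ((2 : ℝ) ^ m)⁻¹ * ∑ j, fderiv ℝ (fun y => u (y, p.2) j) p.1 (basisX m j)) with hΦL
  set ΦR : PairSkeleton m × WienerPair → ℝ := fun p =>
    ∑ j, fderiv ℝ (fun y => G (y, p.2)) p.1 (basisX m j) * u p j with hΦR
  have hΦLm : Measurable ΦL :=
    hGm.mul ((Finset.measurable_sum _ fun j _ =>
      ((measurable_coordX m j).comp measurable_fst).mul (hum j)).sub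
        ((Finset.measurable_sum _ fun j _ => hdum j).const_mul _))
  have hΦRm : Measurable ΦR := Finset.measurable_sum _ fun j _ => (hdGm j).mul (hum j)
  have hΦLi : Integrable (fun wp => ΦL (pairSkel m wp, pairRem m wp)) wienerPair := by
    have h0 : Integrable (fun wp => (∑ j, coordX m (pairSkel m wp) j *
        (G (pairSkel m wp, pairRem m wp) * u (pairSkel m wp, pairRem m wp) j)) -
        ((2 : ℝ) ^ m)⁻¹ * ∑ j, G (pairSkel m wp, pairRem m wp) *
          fderiv ℝ (fun y => u (y, pairRem m wp) j) (pairSkel m wp) (basisX m j)) wienerPair :=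
      (integrable_finsetSum Finset.univ fun j _ => hxGu j).sub
        ((integrable_finsetSum Finset.univ fun j _ => hGdu j).const_mul _)
    refine h0.congr (ae_of_all _ fun wp => ?_)
    simp only [hΦL, mul_sub, Finset.mul_sum]
    congr 1
    · exact Finset.sum_congr rfl fun j _ => by ring
    · exact Finset.sum_congr rfl fun j _ => by ring
  have hΦRi : Integrable (fun wp => ΦR (pairSkel m wp, pairRem m wp)) wienerPair :=
    integrable_finsetSum Finset.univ fun j _ => hdGu j
  -- both sides through the disintegration of file 1 §1
  have e1 : ∫ wp, G (pairSkel m wp, pairRem m wp) *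
        ((∑ j, coordX m (pairSkel m wp) j * u (pairSkel m wp, pairRem m wp) j) -
          ((2 : ℝ) ^ m)⁻¹ * ∑ j, fderiv ℝ (fun y => u (y, pairRem m wp) j) (pairSkel m wp)
            (basisX m j)) ∂wienerPair =
      ∫ wp, ∫ x, ΦL (x, pairRem m wp) ∂(skelGauss m) ∂wienerPair :=
    integral_pairSkel_pairRem hΦLm hΦLi
  have e2 : ∫ wp, ∑ j,
        fderiv ℝ (fun y => G (y, pairRem m wp)) (pairSkel m wp) (basisX m j) *
          u (pairSkel m wp, pairRem m wp) j ∂wienerPair =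
      ∫ wp, ∫ x, ΦR (x, pairRem m wp) ∂(skelGauss m) ∂wienerPair :=
    integral_pairSkel_pairRem hΦRm hΦRi
  rw [e1, e2, ← integral_const_mul]
  -- almost every slice is integrable; apply §1 at almost every remainder
  have hA := fun j => ae_integrable_slice_pairRem (m := m) (hGm.mul (hum j)) (hGu j)
  have hB := fun j => ae_integrable_slice_pairRem (m := m)
    (((measurable_coordX m j).comp measurable_fst).mul (hGm.mul (hum j))) (hxGu j)
  have hC := fun j => ae_integrable_slice_pairRem (m := m) ((hdGm j).mul (hum j)) (hdGu j)
  have hD := fun j => ae_integrable_slice_pairRem (m := m) (hGm.mul (hdum j)) (hGdu j)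
  refine integral_congr_ae ?_
  filter_upwards [ae_all_iff.2 hA, ae_all_iff.2 hB, ae_all_iff.2 hC, ae_all_iff.2 hD]
    with wp h1 h2 h3 h4
  exact skelGauss_ibp_div m (hGd _) (hud _) h1 h2 h3 h4

end Wiener

end Summit.AtomisticToContinuum.FouriersLaw.Theorems.ExtensiveSnapshotIrreversibility.EnergyWindow
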